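import Summits.Ventures.HSemireg.ContractionSpanTwist
import Summits.Ventures.HSemireg.ContractionRankPointIdeal
import HarnessLib

/-!
# Venture HSemireg — the twisted point-ideal class `r(I_p ⊗ M) = r(I_p) = 2·C(n, 2)` (`n ≥ 3`), `= 1` (`n = 2`),
# and sharpness of the twist lemma (a `(2,0)`-twist changes the rank)

HONEST FRAMING. Pure linear algebra in the exterior algebra, joining seat p4's point-ideal rank theorem
(`ContractionSpanPointIdeal.lean`: `dim span L L^⊥ (a·1 + b·ω) = 2·C(n, 2)` for `dim V = 2n`, `dim L = n`, `n ≥ 3`;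
th-7's T_lin, `theory/FORMULA-N-th7.md` §N.2) with seat p6's twist invariance (`ContractionSpanTwist.lean`: the
class-level conjugation lemma `rank span(x ∧ e^{c}) = rank span(x)` for `c ∈ span{v ∧ q : q ∈ L}`). Written for
the computation cell `pub-hsemireg`. Nothing here is a claim about any variety; nothing here says that HC / HC_CM /
HC_AV holds. Everything is PROVED; no named fact, no new definition.

Contents: `rank_span_expSum_mul_eq` / `finrank_span_mul_expSum_eq` (the twist lemma with the twist on the left /
in `finrank` form), the REAL-CARRIER forms `contractionRank_pointIdeal_mul_expSum` (`contractionRank A κ' = 2·C(g,2)`,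
`g ≥ 3`) / `…_two_…` (`= 1`, `g = 2`) over p4's `ContractionRankPointIdeal.lean`, and the two abstract TWISTED point-ideal counts
`finrank_span_pointIdeal_mul_expSum` (`n ≥ 3`: `2·C(n, 2)`) / `finrank_span_pointIdeal_two_mul_expSum` (`n = 2`:
`1`) for the class `(a·1 + b·ω) ∧ e^{c}`, `e^{c} = Σ_{k<N} cᵏ/k!`, `c^N = 0` — by value the total class
`ch(I_p ⊗ M) = (1 - [pt]) · e^{c₁(M)}` of a point-ideal sheaf twisted by a line bundle `M` on an abelian `n`-fold
(`V = H¹`, `L = H^{0,1}`, `ω = [pt]` of top degree, `c = c₁(M)` of type `(1,1)`): th-7's T_lin number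
`r₂(n)` is twist invariant, uniformly in `n`. SHARPNESS (`exists_even_twist_rank_span_lt`): in `Λ(ℚ⁴)` the even
square-zero class `c = e₀ ∧ e₁` with BOTH factors outside `L = {e₂, e₃}` (a «`(2,0)`-class») twists `x = 1` from
contraction rank `≤ 1` to `≥ 2` — the hypothesis `q ∈ L` of the conjugation lemma cannot be dropped (the referee's
clause «a `(2,0)`-part would add a scalar term»). References: [BourbakiAlgebre1a3] Ch. III §7–§8, §11 no. 9;
[BuchweitzFlenner2008HH] Prop. 6.4.4 (why these operators); [Fulton1998] §15.1 (i) (`ch` is a ring homomorphism) and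
(iii) (`ch(L) = e^{c₁(L)}`) for the BY-VALUE input `ch(I_p ⊗ M) = ch(I_p)·e^{c₁(M)}`.
-/

noncomputable section

open CliffordAlgebra (contractLeft)
open ExteriorAlgebra (ι)
open Literature.AlgebraicGeometry.Motives Literature.AlgebraicGeometry.HodgeTheory

namespace Summit.Ventures.HSemireg

namespace ContractionSpan

section Field

variable {K : Type*} [Field K] [CharZero K] {V : Type*} [AddCommGroup V] [Module K V]

/-- The class-level conjugation lemma with the twist written on the LEFT, `rank span(e^{c} ∧ x) = rank span(x)`
(`e^{c}` is central, `ContractionSpan.commute_expSum`). [cite: BuchweitzFlenner2008HH, Prop. 6.4.4] -/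
theorem rank_span_expSum_mul_eq {L : Set V} {Θ : Set (Module.Dual K V)} (hΘL : ∀ θ ∈ Θ, ∀ q ∈ L, θ q = 0)
    {c : ExteriorAlgebra K V}
    (hc : c ∈ Submodule.span K {z : ExteriorAlgebra K V | ∃ v : V, ∃ q ∈ L, z = ι K v * ι K q}) {N : ℕ}
    (hN : c ^ N = 0) (x : ExteriorAlgebra K V) :
    Module.rank K (span L Θ ((∑ k ∈ Finset.range N, ((k.factorial : K)⁻¹) • c ^ k) * x)) =
      Module.rank K (span L Θ x) := by
  rw [(commute_expSum (span_twist_le L hc) N x).eq]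
  exact rank_span_mul_expSum_eq hΘL hc hN x

/-- **The class-level conjugation lemma, `finrank` form**: for `Θ` killing `L`, `c ∈ span{v ∧ q : q ∈ L}` with
`c^N = 0` and `e^{c} = Σ_{k<N} cᵏ/k!`, the contraction spans of `x ∧ e^{c}` and of `x` have the same (finite)
dimension. [cite: BuchweitzFlenner2008HH, Prop. 6.4.4] [cite: BourbakiAlgebre1a3, Ch. III §11 no. 9] -/
theorem finrank_span_mul_expSum_eq {L : Set V} {Θ : Set (Module.Dual K V)} (hΘL : ∀ θ ∈ Θ, ∀ q ∈ L, θ q = 0)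
    {c : ExteriorAlgebra K V}
    (hc : c ∈ Submodule.span K {z : ExteriorAlgebra K V | ∃ v : V, ∃ q ∈ L, z = ι K v * ι K q}) {N : ℕ}
    (hN : c ^ N = 0) (x : ExteriorAlgebra K V) :
    Module.finrank K (span L Θ (x * ∑ k ∈ Finset.range N, ((k.factorial : K)⁻¹) • c ^ k)) =
      Module.finrank K (span L Θ x) := by
  simp only [Module.finrank, rank_span_mul_expSum_eq hΘL hc hN x]

/-- **Twisted T_lin, `n ≥ 3`** (`r(I_p ⊗ M) = r(I_p) = 2·C(n, 2)`): for `dim V = 2n`, `L ⊆ V` of dimension `n`,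
`Θ = {θ : θ|_L = 0}`, `ω ≠ 0` of top degree, `a, b ≠ 0`, a twist class `c ∈ span{v ∧ q : q ∈ L}` with `c^N = 0`
and `e^{c} = Σ_{k<N} cᵏ/k!`, the contraction span of `(a·1 + b·ω) ∧ e^{c}` has dimension `2·C(n, 2)`
(p4's `finrank_span_pointIdeal` transported by `finrank_span_mul_expSum_eq`).
[cite: BourbakiAlgebre1a3, Ch. III §7 no. 8 and §11 no. 9] [cite: BuchweitzFlenner2008HH, Prop. 6.4.4] -/
theorem finrank_span_pointIdeal_mul_expSum [FiniteDimensional K V] {n : ℕ} (hV : Module.finrank K V = 2 * n)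
    (L : Submodule K V) (hL : Module.finrank K L = n) {ω : ExteriorAlgebra K V} (hω : ω ∈ ⋀[K]^(2 * n) V)
    (hω0 : ω ≠ 0) {a b : K} (ha : a ≠ 0) (hb : b ≠ 0) (hn : 3 ≤ n) {c : ExteriorAlgebra K V}
    (hc : c ∈ Submodule.span K {z : ExteriorAlgebra K V | ∃ v : V, ∃ q ∈ (L : Set V), z = ι K v * ι K q})
    {N : ℕ} (hN : c ^ N = 0) :
    Module.finrank K (span (L : Set V) {θ : Module.Dual K V | ∀ q ∈ L, θ q = 0}
      ((algebraMap K _ a + b • ω) * ∑ k ∈ Finset.range N, ((k.factorial : K)⁻¹) • c ^ k)) = 2 * n.choose 2 := by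
  have hΘL : ∀ θ ∈ {θ : Module.Dual K V | ∀ q ∈ L, θ q = 0}, ∀ q ∈ (L : Set V), θ q = 0 :=
    fun θ hθ q hq => hθ q hq
  rw [finrank_span_mul_expSum_eq hΘL hc hN, finrank_span_pointIdeal hV L hL hω hω0 ha hb hn]

/-- **Twisted T_lin, `n = 2`** (`dim V = 4`, `dim L = 2`): the contraction span of `(a·1 + b·ω) ∧ e^{c}` is a LINE
(dimension `1 = C(2, 2)`), exactly as for the untwisted point-ideal class (p4's `finrank_span_pointIdeal_two`).
[cite: BourbakiAlgebre1a3, Ch. III §7 no. 8 and §11 no. 9] [cite: BuchweitzFlenner2008HH, Prop. 6.4.4] -/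
theorem finrank_span_pointIdeal_two_mul_expSum [FiniteDimensional K V] (hV : Module.finrank K V = 4)
    (L : Submodule K V) (hL : Module.finrank K L = 2) {ω : ExteriorAlgebra K V} (hω : ω ∈ ⋀[K]^4 V) {a b : K}
    (ha : a ≠ 0) (hb : b ≠ 0) {c : ExteriorAlgebra K V}
    (hc : c ∈ Submodule.span K {z : ExteriorAlgebra K V | ∃ v : V, ∃ q ∈ (L : Set V), z = ι K v * ι K q})
    {N : ℕ} (hN : c ^ N = 0) :
    Module.finrank K (span (L : Set V) {θ : Module.Dual K V | ∀ q ∈ L, θ q = 0}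
      ((algebraMap K _ a + b • ω) * ∑ k ∈ Finset.range N, ((k.factorial : K)⁻¹) • c ^ k)) = 1 := by
  have hΘL : ∀ θ ∈ {θ : Module.Dual K V | ∀ q ∈ L, θ q = 0}, ∀ q ∈ (L : Set V), θ q = 0 :=
    fun θ hθ q hq => hθ q hq
  rw [finrank_span_mul_expSum_eq hΘL hc hN, finrank_span_pointIdeal_two hV L hL hω ha hb]

end Field

/-! ### Sharpness: an even twist class with a `(2,0)`-part changes the rank -/

section Sharpness

/-- **SHARPNESS — the hypothesis `q ∈ L` («no `(2,0)`-part») cannot be dropped.** In `Λ(ℚ⁴)` with basis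
`e 0, …, e 3`, `L = {e 2, e 3}` («`H^{0,1}`»), `Θ = {θ 0, θ 1}` (coordinate forms; they kill `L`) and the even,
square-zero class `c = e 0 ∧ e 1 ∈ span{v ∧ w}` (a «`(2,0)`-class», NOT in `span{v ∧ q : q ∈ L}`), the twist
`e^{c} = Σ_{k<2} cᵏ/k! = 1 + c` CHANGES the contraction rank of `x = 1`: `rank span(1) ≤ 1` (the line `ℚ·e 2 ∧ e 3`)
but `rank span(1 ∧ e^{c}) ≥ 2` (it contains the scalar `ι_{θ 0} ι_{θ 1}(1 + c) = -1` and `e 2 ∧ e 3 ∧ (1 + c)`) — so,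
by the conjugation lemma `rank_span_mul_expSum_eq` read contrapositively, `c ∉ span{v ∧ q : q ∈ L}` (last conjunct).
This is the referee's clause on (I2-β′): «a `(2,0)`-part of `c` would add a scalar term» (`ref/NOTE-CONJ-LEMMA-1.md`).
[cite: BourbakiAlgebre1a3, Ch. III §11 no. 9] -/
theorem exists_even_twist_rank_span_lt :
    ∃ (L : Set (Fin 4 → ℚ)) (Θ : Set (Module.Dual ℚ (Fin 4 → ℚ))) (c : ExteriorAlgebra ℚ (Fin 4 → ℚ)),
      (∀ θ ∈ Θ, ∀ q ∈ L, θ q = 0) ∧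
      c ∈ Submodule.span ℚ {z : ExteriorAlgebra ℚ (Fin 4 → ℚ) | ∃ v w : Fin 4 → ℚ, z = ι ℚ v * ι ℚ w} ∧
      c ^ 2 = 0 ∧
      Module.rank ℚ (span L Θ (1 : ExteriorAlgebra ℚ (Fin 4 → ℚ))) ≤ 1 ∧
      2 ≤ Module.rank ℚ (span L Θ
        ((1 : ExteriorAlgebra ℚ (Fin 4 → ℚ)) * ∑ k ∈ Finset.range 2, ((k.factorial : ℚ)⁻¹) • c ^ k)) ∧
      c ∉ Submodule.span ℚ {z : ExteriorAlgebra ℚ (Fin 4 → ℚ) | ∃ v : Fin 4 → ℚ, ∃ q ∈ L, z = ι ℚ v * ι ℚ q} := by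
  -- the basis vectors `e i` and coordinate forms `θ i` of `ℚ⁴`; `L = {e 2, e 3}`, `Θ = {θ 0, θ 1}`, `c = e 0 ∧ e 1`
  set e : Fin 4 → (Fin 4 → ℚ) := fun i => Pi.single i 1 with he
  set θ : Fin 4 → Module.Dual ℚ (Fin 4 → ℚ) := fun i => LinearMap.proj i with hθ
  have hθe : ∀ i j : Fin 4, θ i (e j) = if i = j then 1 else 0 := by
    intro i j
    simp only [hθ, he, LinearMap.coe_proj, Function.eval, Pi.single_apply]
  set c : ExteriorAlgebra ℚ (Fin 4 → ℚ) := ι ℚ (e 0) * ι ℚ (e 1) with hc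
  have hexp : (∑ k ∈ Finset.range 2, ((k.factorial : ℚ)⁻¹) • c ^ k) = 1 + c := by
    rw [Finset.sum_range_succ, Finset.sum_range_one, pow_zero, pow_one, Nat.factorial_zero, Nat.factorial_one,
      Nat.cast_one, inv_one, one_smul, one_smul]
  -- contractions of `c` and of `1 + c`
  have hD1c : contractLeft (θ 1) c = -ι ℚ (e 0) := by
    rw [hc, CliffordAlgebra.contractLeft_ι_mul, CliffordAlgebra.contractLeft_ι, hθe, hθe]
    simp
  have hD2c : contractLeft (θ 2) c = 0 := by
    rw [hc, CliffordAlgebra.contractLeft_ι_mul, CliffordAlgebra.contractLeft_ι, hθe, hθe]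
    simp
  have hD3c : contractLeft (θ 3) c = 0 := by
    rw [hc, CliffordAlgebra.contractLeft_ι_mul, CliffordAlgebra.contractLeft_ι, hθe, hθe]
    simp
  have hΘL : ∀ θ' ∈ ({θ 0, θ 1} : Set (Module.Dual ℚ (Fin 4 → ℚ))), ∀ q ∈ ({e 2, e 3} : Set (Fin 4 → ℚ)),
      θ' q = 0 := by
    rintro θ' (rfl | rfl) q (rfl | rfl) <;> simp [hθe]
  have hsq : c ^ 2 = 0 := ι_mul_ι_sq_eq_zero _ _
  -- (a) the untwisted span is the line through `e 2 ∧ e 3`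
  have h4 : Module.rank ℚ (span {e 2, e 3} {θ 0, θ 1} (1 : ExteriorAlgebra ℚ (Fin 4 → ℚ))) ≤ 1 := by
    have h32 : ι ℚ (e 3) * ι ℚ (e 2) = -(ι ℚ (e 2) * ι ℚ (e 3)) :=
      eq_neg_of_add_eq_zero_left (ExteriorAlgebra.ι_add_mul_swap (e 3) (e 2))
    have hle : span {e 2, e 3} {θ 0, θ 1} (1 : ExteriorAlgebra ℚ (Fin 4 → ℚ)) ≤
        Submodule.span ℚ {ι ℚ (e 2) * ι ℚ (e 3)} := by
      refine Submodule.span_le.mpr ?_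
      rintro y ((⟨q₁, hq₁, q₂, hq₂, rfl⟩ | ⟨q, hq, θ', hθ', rfl⟩) | ⟨θ₁, hθ₁, θ₂, hθ₂, rfl⟩)
      · rw [mul_one]
        rcases hq₁ with (rfl | rfl) <;> rcases hq₂ with (rfl | rfl)
        · rw [ExteriorAlgebra.ι_sq_zero]; exact Submodule.zero_mem _
        · exact Submodule.mem_span_singleton_self _
        · rw [h32]; exact Submodule.neg_mem _ (Submodule.mem_span_singleton_self _)
        · rw [ExteriorAlgebra.ι_sq_zero]; exact Submodule.zero_mem _
      · rw [CliffordAlgebra.contractLeft_one, mul_zero]; exact Submodule.zero_mem _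
      · rw [CliffordAlgebra.contractLeft_one, map_zero]; exact Submodule.zero_mem _
    refine (Submodule.rank_mono hle).trans ((rank_span_le _).trans ?_)
    rw [Cardinal.mk_singleton]
  -- (b) the twisted span contains the scalar `1` and `e 2 ∧ e 3 ∧ (1 + c)`, which are independent
  have h5 : 2 ≤ Module.rank ℚ (span {e 2, e 3} {θ 0, θ 1}
      ((1 : ExteriorAlgebra ℚ (Fin 4 → ℚ)) * ∑ k ∈ Finset.range 2, ((k.factorial : ℚ)⁻¹) • c ^ k)) := by
    rw [hexp, one_mul]
    set t : ExteriorAlgebra ℚ (Fin 4 → ℚ) := ι ℚ (e 2) * (ι ℚ (e 3) * (1 + c)) with ht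
    have m1 : (1 : ExteriorAlgebra ℚ (Fin 4 → ℚ)) ∈ span {e 2, e 3} {θ 0, θ 1} (1 + c) := by
      have hg : contractLeft (θ 0) (contractLeft (θ 1) (1 + c)) ∈ span {e 2, e 3} {θ 0, θ 1} (1 + c) :=
        Submodule.subset_span (Or.inr ⟨θ 0, Or.inl rfl, θ 1, Or.inr rfl, rfl⟩)
      rw [map_add, CliffordAlgebra.contractLeft_one, zero_add, hD1c, map_neg, CliffordAlgebra.contractLeft_ι, hθe]
        at hg
      simpa using Submodule.neg_mem _ hg
    have m2 : t ∈ span {e 2, e 3} {θ 0, θ 1} (1 + c) :=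
      Submodule.subset_span (Or.inl (Or.inl ⟨e 2, Or.inl rfl, e 3, Or.inr rfl, rfl⟩))
    -- a functional detecting `t`: `algebraMapInv ∘ ι_{θ 3} ∘ ι_{θ 2}` sends `t ↦ 1` and `1 ↦ 0`
    have hFt : ExteriorAlgebra.algebraMapInv (contractLeft (θ 3) (contractLeft (θ 2) t)) = 1 := by
      have hD2 : contractLeft (θ 2) t = ι ℚ (e 3) * (1 + c) := by
        rw [ht, CliffordAlgebra.contractLeft_ι_mul, CliffordAlgebra.contractLeft_ι_mul, map_add,
          CliffordAlgebra.contractLeft_one, hD2c]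
        simp [hθe]
      have hD3 : contractLeft (θ 3) (ι ℚ (e 3) * (1 + c)) = 1 + c := by
        rw [CliffordAlgebra.contractLeft_ι_mul, map_add, CliffordAlgebra.contractLeft_one, hD3c]
        simp [hθe]
      rw [hD2, hD3, map_add, map_one, hc, map_mul]
      simp [ExteriorAlgebra.algebraMapInv]
    have hF1 : ExteriorAlgebra.algebraMapInv (1 : ExteriorAlgebra ℚ (Fin 4 → ℚ)) = 1 := map_one _
    have h1t : ExteriorAlgebra.algebraMapInv t = 0 := by
      rw [ht, map_mul]
      simp [ExteriorAlgebra.algebraMapInv]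
    have hpair : LinearIndependent ℚ ![(1 : ExteriorAlgebra ℚ (Fin 4 → ℚ)), t] := by
      refine LinearIndependent.pair_iff.mpr fun s s' hst => ?_
      have h1 := congrArg ExteriorAlgebra.algebraMapInv hst
      rw [map_add, map_smul, map_smul, hF1, h1t, smul_zero, add_zero, map_zero, smul_eq_mul, mul_one] at h1
      subst h1
      rw [zero_smul, zero_add] at hst
      have h2 := congrArg (fun y => ExteriorAlgebra.algebraMapInv (contractLeft (θ 3) (contractLeft (θ 2) y))) hst
      simp only [map_smul, hFt, map_zero, smul_eq_mul, mul_one] at h2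
      exact ⟨rfl, h2⟩
    have hli : LinearIndependent ℚ
        (![⟨1, m1⟩, ⟨t, m2⟩] : Fin 2 → span {e 2, e 3} {θ 0, θ 1} (1 + c)) := by
      refine LinearIndependent.of_comp (Submodule.subtype _) ?_
      convert hpair using 1
      funext i
      fin_cases i <;> rfl
    simpa using hli.cardinal_le_rank
  refine ⟨{e 2, e 3}, {θ 0, θ 1}, c, hΘL, Submodule.subset_span ⟨e 0, e 1, rfl⟩, hsq, h4, h5, fun hcL => ?_⟩
  -- (c) were `c` a twist class, the conjugation lemma would force equal ranks: `2 ≤ 1`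
  have h := rank_span_mul_expSum_eq hΘL hcL hsq (1 : ExteriorAlgebra ℚ (Fin 4 → ℚ))
  exact absurd (h5.trans (h.le.trans h4)) (not_le.mpr Cardinal.one_lt_two)

end Sharpness

end ContractionSpan

/-! ### Real carriers: the twisted point-ideal class on an abelian variety (p4's `contractionRank_pointIdeal`) -/

/-- **`r(A, κ') = 2·C(g, 2)` for the TWISTED point-ideal class on an abelian variety of dimension `g ≥ 3`**: if the
total class of `κ` in `Λ H¹(A)` is `a·1 + b·ω` (`a, b ≠ 0`, `ω ≠ 0` of top degree `2g` — «`κ = ch(I_p)`») and that of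
`κ'` is `(a·1 + b·ω) · Σ_{k<N} cᵏ/k!` with `c ∈ span{v ∧ q : q ∈ H^{0,1}}`, `c^N = 0` («`κ' = ch(I_p ⊗ M)`, BY VALUE),
then `contractionRank A κ' = 2·C(g, 2)` — p4's `contractionRank_pointIdeal` transported by the conjugation lemma.
[cite: BuchweitzFlenner2008HH, Prop. 6.4.4] [cite: MumfordAV1970, §1 (4) and §4 (iii)] -/
theorem contractionRank_pointIdeal_mul_expSum (A : AbelianVariety ℂ) (κ κ' : ∀ p : ℕ, complexBetti A.X (2 * p))
    {a b : ℂ} (ha : a ≠ 0) (hb : b ≠ 0) {ω : ExteriorAlgebra ℂ (complexBetti A.X 1)}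
    (hω : ω ∈ ⋀[ℂ]^(2 * A.dim) (complexBetti A.X 1)) (hω0 : ω ≠ 0)
    (hx : totalExteriorClass A κ = algebraMap ℂ _ a + b • ω) (hg : 3 ≤ A.dim)
    {c : ExteriorAlgebra ℂ (complexBetti A.X 1)}
    (hc : c ∈ Submodule.span ℂ {z : ExteriorAlgebra ℂ (complexBetti A.X 1) |
      ∃ v : complexBetti A.X 1, ∃ q ∈ hodgeZeroOneSet A, z = ι ℂ v * ι ℂ q})
    {N : ℕ} (hN : c ^ N = 0)
    (h : totalExteriorClass A κ' = totalExteriorClass A κ * ∑ k ∈ Finset.range N, ((k.factorial : ℂ)⁻¹) • c ^ k) :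
    contractionRank A κ' = ((2 * (A.dim).choose 2 : ℕ) : Cardinal) := by
  rw [contractionRank_eq_of_totalExteriorClass_eq_mul_expSum A hc hN h]
  exact contractionRank_pointIdeal A κ ha hb hω hω0 hx hg

/-- **`r(A, κ') = 1` for the twisted point-ideal class on an abelian SURFACE** (`g = 2`), as for the untwisted one
(p4's `contractionRank_pointIdeal_two`). [cite: BuchweitzFlenner2008HH, Prop. 6.4.4] [cite: MumfordAV1970, §4 (iii)] -/
theorem contractionRank_pointIdeal_two_mul_expSum (A : AbelianVariety ℂ) (κ κ' : ∀ p : ℕ, complexBetti A.X (2 * p))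
    {a b : ℂ} (ha : a ≠ 0) (hb : b ≠ 0) {ω : ExteriorAlgebra ℂ (complexBetti A.X 1)}
    (hω : ω ∈ ⋀[ℂ]^(2 * A.dim) (complexBetti A.X 1))
    (hx : totalExteriorClass A κ = algebraMap ℂ _ a + b • ω) (hg : A.dim = 2)
    {c : ExteriorAlgebra ℂ (complexBetti A.X 1)}
    (hc : c ∈ Submodule.span ℂ {z : ExteriorAlgebra ℂ (complexBetti A.X 1) |
      ∃ v : complexBetti A.X 1, ∃ q ∈ hodgeZeroOneSet A, z = ι ℂ v * ι ℂ q})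
    {N : ℕ} (hN : c ^ N = 0)
    (h : totalExteriorClass A κ' = totalExteriorClass A κ * ∑ k ∈ Finset.range N, ((k.factorial : ℂ)⁻¹) • c ^ k) :
    contractionRank A κ' = 1 := by
  rw [contractionRank_eq_of_totalExteriorClass_eq_mul_expSum A hc hN h]
  exact contractionRank_pointIdeal_two A κ ha hb hω hx hg

end Summit.Ventures.HSemireg

end
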